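import Literature.MathematicalPhysics.QuantumFieldTheory.Balaban1983to89.B15Prop1SliceNondegeneracyFromRealCoerciveTower
import Literature.MathematicalPhysics.QuantumFieldTheory.Balaban1983to89.B15Prop1DatumCoordinatesTowerB

/-!
# `Balaban1983to89.B15Prop1SliceNondegeneracyFromRealCoerciveTower` — [Balaban1989LargeFieldII] = «[LF-II]», (1.9) p. 358, (1.12) p. 359; [Balaban1985Variational] = «[15]», Sect. G pp. 305–307, (181) — **BOND-DATUM EDITION** (`…B15Prop1SliceNondegeneracyFromRealCoerciveTowerB`, USED DECLARATIONS ONLY): the print-datum ([Balaban1984PropagatorsII] (2.3)) twins of the declarations of `B15Prop1SliceNondegeneracyFromRealCoerciveTower` that N12's junction of record v14ᴸ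
uses with a datum-bearing statement (`analyticAt_sliceDatum_of_guardOn`, `eventually_sliceDatum_conj_of_guardOn`, `hnondeg_slice_of_realSecondVariation_pos_of_guardOn`) — class (γ) of dag-n12-c's census-by-declaration v2 (bus [DAGN12C-G35], 2026-08-30).  GENERATOR (block-extracted from the
parent's tree bytes by HOME `lean/g35/gen/gen_blocks.py`): namespace `…B`, SAME names, `DetSet ↦ BDetSet` (F0a), `AgreeOn ↦ AgreeOnB`, `IsMinimizer ↦ IsMinimizerB`, `bondsOf (𝐁 j) ↦ 𝔅 j`, `constrCard ∕
constrEnum ∕ ConstrSet ∕ msChart ↦ …B` (lane `Node00/MultiScaleFibreChartB`), `IsCritOnFibre ∕ IsFibreChartNear ↦ …B`; proofs VERBATIM; the parent's other (datum-free) declarations REUSED by `open`.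

statement-level skeleton of published theorems with citation tags; proofs where landed; nothing here is a claim about
the Yang–Mills mass gap

Cell `pub-ymgap` (HUMAN RULINGS D-0062 ∕ D-0149), lane `pub-ymgap-dag-n12-c` g35 (R134 seat (a), N12 = [B15], s1, lane owner); `--kind proof --supports` K1⁹ `stmt-QuantumFields-27364`; count-neutral.
THEOREMS ONLY (0 `def`, 0 `instance`, 0 `sorry`).  HONESTY GUARD (director-ym №338 (5)): PURELY ADDITIVE — the parent stays landed and true on its own text; nothing in it is edited; no displayed
premise of any consumer is deleted or weakened; every hypothesis stays a hypothesis.  Nothing of Bałaban's analysis asserted; N12 NOT discharged; K0⁷ ∕ K1⁹ NOT closed; one finite 𝕋⁴ programme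
at fixed ε — nothing continuum ∕ ℝ⁴ ∕ OS; the Yang–Mills mass gap (Clay) is NOT proved by any of this.

PARENT's DOCSTRING (mathematics and citations; read `𝐁` as the bond datum `𝔅`):
# `Balaban1983to89.B15Prop1SliceNondegeneracyFromRealCoerciveTower` — [Balaban1989LargeFieldII] = «[LF-II]», (1.9) p. 358, (1.12) p. 359; [Balaban1985Variational] = «[15]», Sect. G pp. 305–307, (181)
# p. 307, Prop. 9 (190) p. 309; [Balaban1989LargeFieldI] Prop. 1 p. 194: (β) ON A GAUGE SLICE FROM POSITIVITY OF THE REAL SECOND VARIATION, UNDER THE PER-TOWER (0.4) GUARDS —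
# the «TP» twin of `B15Prop1SliceNondegeneracyFromRealCoercive` (LOCATED-E1-HSB repair step (r3), link 5∕9)

Honest framing: statement-level skeleton of published theorems with citation tags; proofs where landed; nothing here is a claim about the
Yang–Mills mass gap.  Cell `pub-ymgap`, HUMAN RULING D-0062 (Track A), seat `pub-ymgap-dag-n12-c` g24 (lane owner N12 = [B15], strategy s1; lane memo `N12-UNIFORMITY-SPEC.md` §6,
plan g91 word pub-ymgap INBOX l.45435 «(r3) = ADDITIVE TP-twins»); count-neutral; N12 NOT discharged; finite 𝕋⁴ at fixed ε; nothing continuum ∕ OS ∕ mass-gap ∕ Clay.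

WHAT CHANGES AGAINST THE TWIN (dag-n12-w1's `B15Prop1SliceNondegeneracyFromRealCoercive`, untouched).  The four theorems that read the base configuration's guard
(`eventually_sliceDatum_conj`, `analyticAt_sliceDatum`, ★★★ `hnondeg_slice_of_realSecondVariation_pos`, ★★ `hnondeg_slice_of_secondVariation_pos_of_isLocalMin`) are re-proved VERBATIM
with `hsbU : SmallBelow k U₀` replaced by the ENUMERATED per-tower guards `hgU` at the constrained bonds of `𝔹` (+ `hk : k ≤ m + K`), over `B15Prop1DatumCoordinatesTower`
(`eventually_datumCoord_theta_of_guardOn`, `eventually_analyticAt_datumCoord_of_guardOn`); the guard-free lemmas (`analyticAt_sliceAction`, `sliceAction_realLine`, …) are the twin's.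

CONTENTS (theorems only; no `def`, no `instance`, no `sorry`).  `eventually_sliceDatum_conj_of_guardOn` · `analyticAt_sliceDatum_of_guardOn` · ★★★ `hnondeg_slice_of_realSecondVariation_pos_of_guardOn` ·
★★ `hnondeg_slice_of_secondVariation_pos_of_isLocalMin_of_guardOn`.
-/


noncomputable section

namespace Literature.MathematicalPhysics.QuantumFieldTheory.Balaban1983to89.B15Prop1SliceNondegeneracyFromRealCoerciveTowerB

open B15Prop1SliceNondegeneracyFromRealCoerciveTower


open Set Metric Filter
open scoped Topology ContDiff ComplexConjugate
open Literature.Analysis.Calculus.LagrangeHessianRealCoercive (hnondeg_of_re_pos deriv_deriv_re_comp_realLine fderiv_fderiv_lagrangian_apply hasDerivAt_comp_realLine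
  two_le_add_one_of_ne_zero_withTop)
open Literature.Analysis.Calculus.ConstrainedCriticalFamily (killsKer_of_real)
open Literature.MathematicalPhysics.QuantumFieldTheory.Balaban1983to89.Node00 (SU coeField coeField_apply SmallBelow ConstrSetB constrCardB constrEnumB)
open B15AveragingHolomorphic (iterMh)
open B15ComplexifiedDatumFamily (conjVec conjVec_cplxVec)
open B15SU2ChartHolomorphic (expMulC logCoordC)
open B15Prop1StateChartSU2 (exists_conjCLM_pi conjVec_conjVec conjVec_eq_self_iff expMulC_conjVec_coeField det_expMulC_coeField analyticAt_expMulC_right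
  expMulC_cplxVec_coeField_eq)
open B15Prop1DatumCoordinates (expMulC_zero_left)
open B15Prop1DatumCoordinatesTowerB (eventually_analyticAt_datumCoord_of_guardOn eventually_datumCoord_theta_of_guardOn)
open B15Prop1SliceNondegeneracyFromRealCoercive (smul_coe_cplxVec analyticAt_sliceAction sliceAction_realLine fderiv_sliceDatum_apply_eq_deriv
  hasDerivAt_wilsonAction4_realLine fderiv_sliceAction_apply_cplxVec fderiv_sliceAction_eq_zero_of_isLocalMin isLocalMin_realLine_of_forall_le multiplier_eq_zero_of_fderiv_eq_zero)
open B15Prop1ComplexWilsonAction (analyticAt_actionSum_expMulC actionSum_expMulC_cplxVec)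
open B15Prop1LocalChartAtBaseField (exists_conjCLM_submodule)
open B15Prop1HessianNondegenerateOfRealCoercive (cplxVec_smul)
open B15Prop1AnalyticExtClause (cplxVec)
open B15Prop1ChartCalculusSU2 (E3)
open B15Prop1ChartSU2 (su2Chart)
open B16Sect1Backgrounds (expMul)
open ExpMeanLog (expMeanLogSU)
open BlockAveraging (blockAvg)
open T4CubeChartGnomonic (SU2)
open T4Continuum B15DeterminingSets B15DeterminingSetsB GaugeField
open scoped Matrix.Norms.L2Operator

variable {P : Params}



section
variable (S : Submodule ℂ (VecField P 0 (EuclideanSpace ℂ (Fin 3))))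
variable {U₀ : GaugeField P 0 SU2}

/-- **THE SLICE DATUM COORDINATES ARE ANALYTIC AT THE BASE** (logarithmic coordinates analytic near the base datum, state chart analytic). [cite: Balaban1985Variational, Sect. G p.307; Balaban1989LargeFieldI, Prop. 1 p.194] -/
theorem analyticAt_sliceDatum_of_guardOn (𝔅 : BDetSet P) (k : ℕ) (hk : k ≤ P.m + P.K) (W : MSField P SU2)
    (hgU : ∀ i : Fin (constrCardB 𝔅 k), ∀ j', j' < (((constrEnumB 𝔅 k).symm i).1 : ℕ) → ∀ c' : PBond P (j' + 1),
      c' ∈ B10Eq42TorusConstraint.bondsIn (j' + 1) (B14.Eq22Determines.blockIter (((constrEnumB 𝔅 k).symm i).1 : ℕ) ⁻¹'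
        ({((constrEnumB 𝔅 k).symm i).2.1.src, ((constrEnumB 𝔅 k).symm i).2.1.tgt} : Set (Site P ((constrEnumB 𝔅 k).symm i).1))) →
        BlockAveraging.Small expMeanLogSU (Averaging.iter (fun j => blockAvg (P := P) (j := j) expMeanLogSU) j' U₀) c')
    (hU₀ : AgreeOnB 𝔅 (avgFamily (fun j => blockAvg (P := P) (j := j) expMeanLogSU) U₀) W)
    {Φ₀ : S → Fin (constrCardB 𝔅 k) → EuclideanSpace ℂ (Fin 3)}
    (hΦ₀ : ∀ (X : S) i, Φ₀ X i = logCoordC (star ((W ((constrEnumB 𝔅 k).symm i).1 ((constrEnumB 𝔅 k).symm i).2.1 : SU2) : Matrix (Fin 2) (Fin 2) ℂ) *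
      iterMh ((constrEnumB 𝔅 k).symm i).1 (expMulC (X : VecField P 0 (EuclideanSpace ℂ (Fin 3))) (coeField U₀)) ((constrEnumB 𝔅 k).symm i).2.1)) :
    AnalyticAt ℂ Φ₀ 0 := by
  set κ : (PBond P 0 → Matrix (Fin 2) (Fin 2) ℂ) → Fin (constrCardB 𝔅 k) → EuclideanSpace ℂ (Fin 3) := fun Q i =>
    logCoordC (star ((W ((constrEnumB 𝔅 k).symm i).1 ((constrEnumB 𝔅 k).symm i).2.1 : SU2) : Matrix (Fin 2) (Fin 2) ℂ) *
      iterMh ((constrEnumB 𝔅 k).symm i).1 Q ((constrEnumB 𝔅 k).symm i).2.1) with hκdef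
  have hκ : ∀ Q i, κ Q i = logCoordC (star ((W ((constrEnumB 𝔅 k).symm i).1 ((constrEnumB 𝔅 k).symm i).2.1 : SU2) : Matrix (Fin 2) (Fin 2) ℂ) *
      iterMh ((constrEnumB 𝔅 k).symm i).1 Q ((constrEnumB 𝔅 k).symm i).2.1) := fun Q i => rfl
  set χ : S → PBond P 0 → Matrix (Fin 2) (Fin 2) ℂ := fun X => expMulC (X : VecField P 0 (EuclideanSpace ℂ (Fin 3))) (coeField U₀) with hχdef
  have hχ0 : χ 0 = coeField U₀ := by
    show expMulC ((0 : S) : VecField P 0 (EuclideanSpace ℂ (Fin 3))) (coeField U₀) = coeField U₀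
    rw [Submodule.coe_zero, expMulC_zero_left]
  have hχan : AnalyticAt ℂ χ 0 := (analyticAt_expMulC_right (coeField U₀) _).comp (S.subtypeL.analyticAt 0)
  have hfun : Φ₀ = fun X : S => κ (χ X) := funext fun X => funext fun i => by rw [hΦ₀, hκ]
  rw [hfun]
  have hκan : ∀ᶠ Q in 𝓝 (coeField U₀), AnalyticAt ℂ κ Q := eventually_analyticAt_datumCoord_of_guardOn 𝔅 k hk W κ hκ hgU hU₀
  have h1 : AnalyticAt ℂ κ (χ 0) := by rw [hχ0]; exact hκan.self_of_nhds
  exact h1.comp hχan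

end

section
variable (S : Submodule ℂ (VecField P 0 (EuclideanSpace ℂ (Fin 3))))
variable {U₀ : GaugeField P 0 SU2}

/-- **LOCAL CONJUGATION-EQUIVARIANCE OF THE SLICE DATUM COORDINATES**: with `cE` the conjugation of the stable slice (acting as `conjVec`) and `cF` coordinatewise conjugation,
`Φ₀ (cE X) = cF (Φ₀ X)` for `X` near `0` — from the `θ`-covariance of the logarithmic coordinates near the base (`eventually_datumCoord_theta`) and of the state chart
(`expMulC_conjVec_coeField`). [cite: Balaban1985Variational, Sect. G p.307, (181) p.307; Balaban1989LargeFieldI, Prop. 1 p.194 (last clause: «real for real arguments»)] -/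
theorem eventually_sliceDatum_conj_of_guardOn (𝔅 : BDetSet P) (k : ℕ) (hk : k ≤ P.m + P.K) (W : MSField P SU2)
    (hgU : ∀ i : Fin (constrCardB 𝔅 k), ∀ j', j' < (((constrEnumB 𝔅 k).symm i).1 : ℕ) → ∀ c' : PBond P (j' + 1),
      c' ∈ B10Eq42TorusConstraint.bondsIn (j' + 1) (B14.Eq22Determines.blockIter (((constrEnumB 𝔅 k).symm i).1 : ℕ) ⁻¹'
        ({((constrEnumB 𝔅 k).symm i).2.1.src, ((constrEnumB 𝔅 k).symm i).2.1.tgt} : Set (Site P ((constrEnumB 𝔅 k).symm i).1))) →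
        BlockAveraging.Small expMeanLogSU (Averaging.iter (fun j => blockAvg (P := P) (j := j) expMeanLogSU) j' U₀) c')
    (hU₀ : AgreeOnB 𝔅 (avgFamily (fun j => blockAvg (P := P) (j := j) expMeanLogSU) U₀) W)
    {Φ₀ : S → Fin (constrCardB 𝔅 k) → EuclideanSpace ℂ (Fin 3)}
    (hΦ₀ : ∀ (X : S) i, Φ₀ X i = logCoordC (star ((W ((constrEnumB 𝔅 k).symm i).1 ((constrEnumB 𝔅 k).symm i).2.1 : SU2) : Matrix (Fin 2) (Fin 2) ℂ) *
      iterMh ((constrEnumB 𝔅 k).symm i).1 (expMulC (X : VecField P 0 (EuclideanSpace ℂ (Fin 3))) (coeField U₀)) ((constrEnumB 𝔅 k).symm i).2.1))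
    {cE : S →L⋆[ℂ] S} (hcE : ∀ X : S, ((cE X : S) : VecField P 0 (EuclideanSpace ℂ (Fin 3))) = conjVec (X : VecField P 0 (EuclideanSpace ℂ (Fin 3))))
    {cF : (Fin (constrCardB 𝔅 k) → EuclideanSpace ℂ (Fin 3)) →L⋆[ℂ] (Fin (constrCardB 𝔅 k) → EuclideanSpace ℂ (Fin 3))} (hcF : ∀ v i b, cF v i b = conj (v i b)) :
    ∀ᶠ X in 𝓝 (0 : S), Φ₀ (cE X) = cF (Φ₀ X) := by
  set κ : (PBond P 0 → Matrix (Fin 2) (Fin 2) ℂ) → Fin (constrCardB 𝔅 k) → EuclideanSpace ℂ (Fin 3) := fun Q i =>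
    logCoordC (star ((W ((constrEnumB 𝔅 k).symm i).1 ((constrEnumB 𝔅 k).symm i).2.1 : SU2) : Matrix (Fin 2) (Fin 2) ℂ) *
      iterMh ((constrEnumB 𝔅 k).symm i).1 Q ((constrEnumB 𝔅 k).symm i).2.1) with hκdef
  have hκ : ∀ Q i, κ Q i = logCoordC (star ((W ((constrEnumB 𝔅 k).symm i).1 ((constrEnumB 𝔅 k).symm i).2.1 : SU2) : Matrix (Fin 2) (Fin 2) ℂ) *
      iterMh ((constrEnumB 𝔅 k).symm i).1 Q ((constrEnumB 𝔅 k).symm i).2.1) := fun Q i => rfl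
  set χ : S → PBond P 0 → Matrix (Fin 2) (Fin 2) ℂ := fun X => expMulC (X : VecField P 0 (EuclideanSpace ℂ (Fin 3))) (coeField U₀) with hχdef
  have hχ0 : χ 0 = coeField U₀ := by
    show expMulC ((0 : S) : VecField P 0 (EuclideanSpace ℂ (Fin 3))) (coeField U₀) = coeField U₀
    rw [Submodule.coe_zero, expMulC_zero_left]
  have hχcont : ContinuousAt χ 0 := ((analyticAt_expMulC_right (coeField U₀) _).comp (S.subtypeL.analyticAt 0)).continuousAt
  have hχt : Tendsto χ (𝓝 0) (𝓝 (coeField U₀)) := by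
    have h := hχcont.tendsto; rwa [hχ0] at h
  have hχθ : ∀ (X : S) b, χ (cE X) b = (star (χ X b))⁻¹ := fun X b => by
    show expMulC ((cE X : S) : VecField P 0 (EuclideanSpace ℂ (Fin 3))) (coeField U₀) b = _
    rw [hcE]
    exact expMulC_conjVec_coeField U₀ _ b
  have hχdet : ∀ (X : S) b, (χ X b).det = 1 := fun X b => det_expMulC_coeField U₀ _ b
  have hΦ₀κ : ∀ X : S, Φ₀ X = κ (χ X) := fun X => funext fun i => by rw [hΦ₀, hκ]
  have hκθ : ∀ᶠ Q in 𝓝 (coeField U₀), (∀ b, IsUnit (Q b).det) → κ (fun b => (star (Q b))⁻¹) = cF (κ Q) :=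
    eventually_datumCoord_theta_of_guardOn 𝔅 k hk W κ hκ hgU hU₀ cF hcF
  filter_upwards [hχt.eventually hκθ] with X hX
  rw [hΦ₀κ, hΦ₀κ]
  have hunit : ∀ b, IsUnit (χ X b).det := fun b => by rw [hχdet]; exact isUnit_one
  have h := hX hunit
  have hfun : χ (cE X) = fun b => (star (χ X b))⁻¹ := funext (hχθ X)
  rw [hfun]
  exact h

end

section

/-- ★★★ **THE (β) LETTER `hnondeg` ON A GAUGE SLICE FROM POSITIVITY OF THE REAL SECOND VARIATION ALONG REAL SLICE FIELDS.**  Objects: a conjugation-stable slice `S`; the base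
configuration `U₀` with the guards `SmallBelow … k U₀`, `AgreeOnB 𝔅 (avgFamily av U₀) W` (the logarithmic coordinates are taken relative to the base datum `W`); the slice action
`a` and slice datum coordinates `Φ₀`, characterised pointwise EXACTLY as in `B15Prop1LocalChartAtBaseField.exists_localChart_at_baseField`; any `ℓ₀`.  HYPOTHESIS (the real
(β) estimate, [LF-II] (1.9) read at the background): for every real bond field `p ≠ 0` with `cplxVec p ∈ S` in the kernel of the linearised constraint (`DΦ₀(0) ⟨cplxVec p, _⟩ = 0`),

  `0 < d²∕dt² [ wilsonAction4 (expMul su2Chart (t • p) U₀) − Re ℓ₀ (Φ₀ ((t:ℂ) • ⟨cplxVec p, _⟩)) ] |_{t=0}`.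

CONCLUSION: the letter `hnondeg` of `exists_localChart_at_baseField` ∕ `hMin_of_rightInverseLetters` for this `ℓ₀`, VERBATIM.  Proof: n12-w2's `hnondeg_of_re_pos` on `E := S`
with the slice conjugation; its local equivariance input is `eventually_sliceDatum_conj`, its regularity inputs `analyticAt_sliceAction` ∕ `analyticAt_sliceDatum`; a real
vector of `S` is `cplxVec p` (`conjVec_eq_self_iff`); the diagonal Hessian's real part is the second derivative of the real restriction (`deriv_deriv_re_comp_realLine`,
`fderiv_fderiv_lagrangian_apply`), and the real restriction of `a` is the Wilson action (`sliceAction_realLine`).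
[cite: Balaban1989LargeFieldII, (1.9) p.358, (1.12) p.359, p.359 («positive, hence invertible on this subspace. Thus we can apply the implicit function theorem»); Balaban1985Variational, Sect. G pp.305–307, (181) p.307, Prop. 9 (190) p.309; Balaban1989LargeFieldI, Prop. 1 p.194 (last clause); LuenbergerYe2008, §10.7 p.307, §11.5] -/
theorem hnondeg_slice_of_realSecondVariation_pos_of_guardOn (𝔅 : BDetSet P) (k : ℕ) (hk : k ≤ P.m + P.K) (W : MSField P SU2) {U₀ : GaugeField P 0 SU2}
    (hgU : ∀ i : Fin (constrCardB 𝔅 k), ∀ j', j' < (((constrEnumB 𝔅 k).symm i).1 : ℕ) → ∀ c' : PBond P (j' + 1),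
      c' ∈ B10Eq42TorusConstraint.bondsIn (j' + 1) (B14.Eq22Determines.blockIter (((constrEnumB 𝔅 k).symm i).1 : ℕ) ⁻¹'
        ({((constrEnumB 𝔅 k).symm i).2.1.src, ((constrEnumB 𝔅 k).symm i).2.1.tgt} : Set (Site P ((constrEnumB 𝔅 k).symm i).1))) →
        BlockAveraging.Small expMeanLogSU (Averaging.iter (fun j => blockAvg (P := P) (j := j) expMeanLogSU) j' U₀) c')
    (hU₀ : AgreeOnB 𝔅 (avgFamily (fun j => blockAvg (P := P) (j := j) expMeanLogSU) U₀) W)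
    (S : Submodule ℂ (VecField P 0 (EuclideanSpace ℂ (Fin 3)))) (hS : ∀ X ∈ S, conjVec X ∈ S)
    (a : S → ℂ)
    (ha : ∀ X : S, a X = ∑ q : Plaq P 0, (1 - (expMulC (X : VecField P 0 (EuclideanSpace ℂ (Fin 3))) (coeField U₀) ⟨q.src, q.μ⟩ *
      expMulC (X : VecField P 0 (EuclideanSpace ℂ (Fin 3))) (coeField U₀) ⟨q.src.shift q.μ, q.ν⟩ *
      Matrix.adjugate (expMulC (X : VecField P 0 (EuclideanSpace ℂ (Fin 3))) (coeField U₀) ⟨q.src.shift q.ν, q.μ⟩) *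
      Matrix.adjugate (expMulC (X : VecField P 0 (EuclideanSpace ℂ (Fin 3))) (coeField U₀) ⟨q.src, q.ν⟩)).trace / 2))
    (Φ₀ : S → Fin (constrCardB 𝔅 k) → EuclideanSpace ℂ (Fin 3))
    (hΦ₀ : ∀ (X : S) i, Φ₀ X i = logCoordC (star ((W ((constrEnumB 𝔅 k).symm i).1 ((constrEnumB 𝔅 k).symm i).2.1 : SU2) : Matrix (Fin 2) (Fin 2) ℂ) *
      iterMh ((constrEnumB 𝔅 k).symm i).1 (expMulC (X : VecField P 0 (EuclideanSpace ℂ (Fin 3))) (coeField U₀)) ((constrEnumB 𝔅 k).symm i).2.1))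
    (ℓ₀ : (Fin (constrCardB 𝔅 k) → EuclideanSpace ℂ (Fin 3)) →L[ℂ] ℂ)
    -- the REAL (β) estimate along real slice fields in the kernel of the linearised constraint
    (hpos : ∀ (p : VecField P 0 E3) (hp : cplxVec p ∈ S), p ≠ 0 → fderiv ℂ Φ₀ 0 ⟨cplxVec p, hp⟩ = 0 →
      0 < deriv (deriv (fun t : ℝ => wilsonAction4 (expMul su2Chart (t • p) U₀) - (ℓ₀ (Φ₀ ((t : ℂ) • ⟨cplxVec p, hp⟩))).re)) 0) :
    ∀ s : S, fderiv ℂ Φ₀ 0 s = 0 →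
      (∀ t : S, fderiv ℂ Φ₀ 0 t = 0 → fderiv ℂ (fderiv ℂ a) 0 s t - ℓ₀ (fderiv ℂ (fderiv ℂ Φ₀) 0 s t) = 0) → s = 0 := by
  -- the conjugations
  obtain ⟨cE, hcE, hcEinv⟩ := exists_conjCLM_submodule S hS
  obtain ⟨cF, hcF, hcFinv⟩ := exists_conjCLM_pi (Fin (constrCardB 𝔅 k))
  -- regularity and local equivariance
  have ha2 : ContDiffAt ℂ ((1 : WithTop ℕ∞) + 1) a 0 := (analyticAt_sliceAction S ha 0).contDiffAt
  have hΦ2 : ContDiffAt ℂ ((1 : WithTop ℕ∞) + 1) Φ₀ 0 := (analyticAt_sliceDatum_of_guardOn S 𝔅 k hk W hgU hU₀ hΦ₀).contDiffAt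
  have hloc : ∀ᶠ X in 𝓝 (0 : S), Φ₀ (cE X) = cF (Φ₀ X) := eventually_sliceDatum_conj_of_guardOn S 𝔅 k hk W hgU hU₀ hΦ₀ hcE hcF
  have hx₀ : cE 0 = 0 := map_zero cE
  have hn : (2 : WithTop ℕ∞) ≤ (1 : WithTop ℕ∞) + 1 := two_le_add_one_of_ne_zero_withTop one_ne_zero
  have hL : ContDiffAt ℂ ((1 : WithTop ℕ∞) + 1) (fun X => a X - ℓ₀ (Φ₀ X)) 0 := ha2.sub (ℓ₀.contDiff.contDiffAt.comp _ hΦ2)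
  refine hnondeg_of_re_pos cE cF (m := 1) one_ne_zero ℓ₀ ha2 hΦ2 hcEinv hcFinv hx₀ hloc fun u hu hker hne => ?_
  -- a non-zero real vector of the slice is `cplxVec p`, `p ≠ 0`
  have hureal : conjVec (u : VecField P 0 (EuclideanSpace ℂ (Fin 3))) = (u : VecField P 0 (EuclideanSpace ℂ (Fin 3))) := by
    rw [← hcE, hu]
  obtain ⟨p, hp⟩ := (conjVec_eq_self_iff _).1 hureal
  have hpS : cplxVec p ∈ S := by rw [← hp]; exact u.2
  have hu' : u = ⟨cplxVec p, hpS⟩ := Subtype.ext hp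
  have hpne : p ≠ 0 := by
    rintro rfl
    apply hne
    rw [hu']
    apply Subtype.ext
    show cplxVec (0 : VecField P 0 E3) = 0
    funext b; ext i; simp [cplxVec]
  subst hu'
  -- the diagonal Hessian's real part is the second derivative of the real restriction, which is the displayed real letter
  have h := hpos p hpS hpne hker
  have hfun : (fun t : ℝ => wilsonAction4 (expMul su2Chart (t • p) U₀) - (ℓ₀ (Φ₀ ((t : ℂ) • ⟨cplxVec p, hpS⟩))).re) =
      fun t : ℝ => ((fun X => a X - ℓ₀ (Φ₀ X)) ((0 : S) + (t : ℂ) • ⟨cplxVec p, hpS⟩)).re := by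
    funext t
    rw [zero_add, Complex.sub_re, sliceAction_realLine S ha hpS t, Complex.ofReal_re]
  rw [hfun, deriv_deriv_re_comp_realLine (⟨cplxVec p, hpS⟩ : S) hL hn, fderiv_fderiv_lagrangian_apply ℓ₀ ha2 hΦ2 hn] at h
  exact h

end

end Literature.MathematicalPhysics.QuantumFieldTheory.Balaban1983to89.B15Prop1SliceNondegeneracyFromRealCoerciveTowerB

end
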